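import Mathlib
import HarnessLib
import Summits.HubbardSuperconductivity.HubbardSuperconductivity.Theorems.WeakCouplingBCSWcbcsKohnLuttingerB1gMuWindow
import Summits.HubbardSuperconductivity.HubbardSuperconductivity.Theorems.WeakCouplingBCSKlCertFillingLowerD010
import Summits.HubbardSuperconductivity.HubbardSuperconductivity.Theorems.WeakCouplingBCSKlCertFillingUpperD020
import Summits.HubbardSuperconductivity.HubbardSuperconductivity.Theorems.WeakCouplingBCSKlCertFillingLowerD012
import Summits.HubbardSuperconductivity.HubbardSuperconductivity.Theorems.WeakCouplingBCSKlCertFillingUpperD012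
import Summits.HubbardSuperconductivity.HubbardSuperconductivity.Theorems.WeakCouplingBCSKlCertFillingLowerD018
import Summits.HubbardSuperconductivity.HubbardSuperconductivity.Theorems.WeakCouplingBCSKlCertFillingUpperD018

/-!
# Route `WeakCouplingBCS` — support item `WcbcsKohnLuttingerB1g` (stmt-HubbardSuperconductivity-0158):
# δ-SUB-WINDOWS of the window of record — `μ(δ)` brackets at the interior record ends `μ = -0.2275, -0.3775`

The window records of the certificate half split `μ ∈ [-0.42749, -0.1775] ⊃ μ([0.10, 0.20])` at `μ = -0.3775` and `μ = -0.2275`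
(`klCertB1gWinA | WinB | WinC`, and the two-sided records `…WinAT | WinBT | WinCT`).  To read per-sub-window statements in the consumer's
currency `δ` (`μ(δ) = chemicalPotentialOfDensity ε₀ (1 - δ)`), this file brackets the hole dopings of the two interior ends by certified
fillings (`klfillL012_filling_ge : 0.8775 ≤ n(-0.2275)`, `klfillU012_filling_le : n(-0.2275) ≤ 0.88`, `klfillL018_filling_ge : 0.817 ≤ n(-0.3775)`,
`klfillU018_filling_le : n(-0.3775) ≤ 0.8195`; true values `0.878889`, `0.818354`) and inverts the strictly increasing filling
(`chemicalPotentialOfDensity_window`):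

* `muOfDoping_mem_subwindow_d0100_d0120` — `δ ∈ [0.10, 0.120] ⟹ μ(δ) ∈ [-0.2275, -0.1775]` (window `C`);
* `muOfDoping_mem_subwindow_d01225_d01805` — `δ ∈ [0.1225, 0.1805] ⟹ μ(δ) ∈ [-0.3775, -0.2275]` (window `B`);
* `muOfDoping_mem_subwindow_d0183_d0200` — `δ ∈ [0.183, 0.20] ⟹ μ(δ) ∈ [-0.42749, -0.3775]` (window `A`).

The gaps `(0.120, 0.1225)` and `(0.1805, 0.183)` around `δ(-0.2275) = 0.12111…` and `δ(-0.3775) = 0.18165…` are covered by the uniform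
window statement (`muOfDoping_mem_window_d010_d020`).  Unconditional; all ingredients are kernel-checked polygon certificates.  Folklore.
-/

noncomputable section

-- the tree's namespace `Summit.<Summit>.<Problem>.Theorems` repeats the summit name by design (D-0017)
set_option linter.dupNamespace false

namespace Summit.HubbardSuperconductivity.HubbardSuperconductivity.Theorems

open MeasureTheory Literature.MathematicalPhysics.QuantumLattice

/-- **`μ(δ) ∈ [-0.2275, -0.1775]` for every `δ ∈ [0.10, 0.120]`** (certified fillings `n(-0.1775) ≥ 9/10`, `n(-0.2275) ≤ 22/25`).
[folklore] -/
theorem muOfDoping_mem_subwindow_d0100_d0120 :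
    ∀ δ ∈ Set.Icc (0.10 : ℝ) 0.120,
      chemicalPotentialOfDensity (squareDispersion 1 0) (1 - δ) ∈ Set.Icc (-0.2275 : ℝ) (-0.1775) := by
  obtain ⟨-, -, -, H⟩ := chemicalPotentialOfDensity_window (μ₁ := (-0.1775 : ℝ)) (μ₂ := (-0.2275 : ℝ))
    (by norm_num) (by norm_num) (by norm_num)
  have hlo := klfillL010_filling_ge
  have hhi := klfillU012_filling_le
  rw [show (-(71 / 400) : ℝ) = -0.1775 by norm_num] at hlo
  rw [show (-(91 / 400) : ℝ) = -0.2275 by norm_num] at hhi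
  intro δ hδ
  refine H δ ⟨?_, ?_⟩
  · norm_num at hδ hlo ⊢; linarith [hδ.1]
  · norm_num at hδ hhi ⊢; linarith [hδ.2]

/-- **`μ(δ) ∈ [-0.3775, -0.2275]` for every `δ ∈ [0.1225, 0.1805]`** (certified fillings `n(-0.2275) ≥ 351/400`, `n(-0.3775) ≤ 1639/2000`).
[folklore] -/
theorem muOfDoping_mem_subwindow_d01225_d01805 :
    ∀ δ ∈ Set.Icc (0.1225 : ℝ) 0.1805,
      chemicalPotentialOfDensity (squareDispersion 1 0) (1 - δ) ∈ Set.Icc (-0.3775 : ℝ) (-0.2275) := by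
  obtain ⟨-, -, -, H⟩ := chemicalPotentialOfDensity_window (μ₁ := (-0.2275 : ℝ)) (μ₂ := (-0.3775 : ℝ))
    (by norm_num) (by norm_num) (by norm_num)
  have hlo := klfillL012_filling_ge
  have hhi := klfillU018_filling_le
  rw [show (-(91 / 400) : ℝ) = -0.2275 by norm_num] at hlo
  rw [show (-(151 / 400) : ℝ) = -0.3775 by norm_num] at hhi
  intro δ hδ
  refine H δ ⟨?_, ?_⟩
  · norm_num at hδ hlo ⊢; linarith [hδ.1]
  · norm_num at hδ hhi ⊢; linarith [hδ.2]

/-- **`μ(δ) ∈ [-0.42749, -0.3775]` for every `δ ∈ [0.183, 0.20]`** (certified fillings `n(-0.3775) ≥ 817/1000`, `n(-0.42749) ≤ 4/5`).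
[folklore] -/
theorem muOfDoping_mem_subwindow_d0183_d0200 :
    ∀ δ ∈ Set.Icc (0.183 : ℝ) 0.20,
      chemicalPotentialOfDensity (squareDispersion 1 0) (1 - δ) ∈ Set.Icc (-0.42749 : ℝ) (-0.3775) := by
  obtain ⟨-, -, -, H⟩ := chemicalPotentialOfDensity_window (μ₁ := (-0.3775 : ℝ)) (μ₂ := (-0.42749 : ℝ))
    (by norm_num) (by norm_num) (by norm_num)
  have hlo := klfillL018_filling_ge
  have hhi := klfillU020_filling_le
  rw [show (-(151 / 400) : ℝ) = -0.3775 by norm_num] at hlo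
  rw [show (-(42749 / 100000) : ℝ) = -0.42749 by norm_num] at hhi
  intro δ hδ
  refine H δ ⟨?_, ?_⟩
  · norm_num at hδ hlo ⊢; linarith [hδ.1]
  · norm_num at hδ hhi ⊢; linarith [hδ.2]

/-- **The hole doping of the interior record end `μ = -0.2275`**: `1 - n(-0.2275) ∈ [0.120, 0.1225]` (true `0.12111…`). [folklore] -/
theorem doping_of_mu_m02275_mem : 1 - KohnLuttinger.filling (squareDispersion 1 0) (-0.2275) ∈ Set.Icc (0.120 : ℝ) 0.1225 := by
  have hlo := klfillL012_filling_ge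
  have hhi := klfillU012_filling_le
  rw [show (-(91 / 400) : ℝ) = -0.2275 by norm_num] at hlo hhi
  constructor
  · norm_num at hhi ⊢; linarith
  · norm_num at hlo ⊢; linarith

/-- **The hole doping of the interior record end `μ = -0.3775`**: `1 - n(-0.3775) ∈ [0.1805, 0.183]` (true `0.18165…`). [folklore] -/
theorem doping_of_mu_m03775_mem : 1 - KohnLuttinger.filling (squareDispersion 1 0) (-0.3775) ∈ Set.Icc (0.1805 : ℝ) 0.183 := by
  have hlo := klfillL018_filling_ge
  have hhi := klfillU018_filling_le
  rw [show (-(151 / 400) : ℝ) = -0.3775 by norm_num] at hlo hhi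
  constructor
  · norm_num at hhi ⊢; linarith
  · norm_num at hlo ⊢; linarith

end Summit.HubbardSuperconductivity.HubbardSuperconductivity.Theorems

end
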